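import Summits.ResolutionOfSingularities.ResolutionOfSingularities.Theorems.WeightedInvariantIota3CurveFracTieZeroSigmaReduction
import Summits.ResolutionOfSingularities.ResolutionOfSingularities.Theorems.WeightedInvariantIota3TieZeroTransformShape
import HarnessLib

/-!
# The ORDER letter is STATIONARY at the pinned successor, and the gap list of `stub_keyRungGrHomLE_three` with the curve regime cut to
# (ISO) + (SIGMA) (door `HypersurfaceCentreConstruction`, stmt-ResolutionOfSingularities-19897)

Helper for `stub_keyRungGrHomLE_three` (def-free, `--supports 19897`).  Sequel of …Iota3CurveFracTieZeroSigmaReduction (this hand) on top of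
hand -9's …Iota3TieZeroOrderPersists / …Iota3TieZeroTransformShape / …KeyRungThreeOfDropCurveFracTieZero.

* **`Iota3.transform_not_mem_pow_succ_of_normalForm`** — at the pinned `t`-homogeneous successor `𝔫` (regular local threefold `B_𝔫` with
  regular system of parameters `(t⁻¹, z, W)/1`, `y = (t⁻¹)^r W`) of `f = c y^ν + h` (`c` a unit, `h ∈ 𝒥_{rν+1}((y,x);(r,q))`), every
  saturated transform has `g/1 ∉ 𝔪_{B_𝔫}^{ν+1}`: by …TieZeroTransformShape `g = c W^ν + t⁻¹ H`, and a unit monomial `c W^ν` does not hide in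
  `𝒥_{ν+1}((t⁻¹, z, W); (ν+1, 1, 1)) ⊇ 𝔪^{ν+1} + (t⁻¹)` (weighted quasi-regularity, …Iota3TieLocusNormal).  With hand -9's
  `transform_mem_pow_of_mem_tieZero` (`g/1 ∈ 𝔪^ν`): **the order letter is stationary, `ord g/1 = ν = ord f`**.
* **`keyRungGrHomLE_three_of_tieDescent_point_curveFracTieZeroSigma`** (GAP LIST OF RECORD, this hand) and its (c11)-form
  **`keyRungGrHomLE_three_of_c11_point_curveFracTieZeroSigma`** — `KeyRungGrHomLE 3 p ⟸` hD (resp. (c11)≤3) + (D-b³-point) [the crux] +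
  **(D-b³-curve-FRAC-TIE-ZERO-ISO-SIGMA)**: in the setting of hand -9's (D-b³-curve-FRAC-TIE-ZERO) (fractional-slope curve centre tied at
  `λ = 0`, ANY presentation, THE pinned successor `𝔫 = (t⁻¹, z, W)` with its regular-threefold datum), show
  (ISO) `IsIsolatedPosition (B_𝔫) (g/1)` — the equimultiple locus of `g/1` is the closed point — AND
  (SIGMA) `iotaSigma (B_𝔫) (g/1) < iotaSigma (S_P) (f/1)` — the flag-slope letter drops against its TRANSVERSAL value at the centre.
  The letters `ν, ε, τ` and the cylinder readings are discharged by …CurveFracTieZeroSigmaReduction; given (ISO), (SIGMA) is also NECESSARY.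

[OURS · L1 W4.3 · audit glue; AI work, weaker than expert review; nothing here is a statement of the manuscript under review
(Hironaka 2017, [claim: Hironaka2017, status: under-review]).]

## References

* J. Włodarczyk, *Functorial resolution by torus actions*, arXiv:2203.03090, §3.3 (charts of the cobordant blow-up). [Wlodarczyk2022]
* H. Matsumura, *Commutative Ring Theory*, CUP 1986, Thm. 16.2 (quasi-regularity of a regular system of parameters). [Matsumura1987]
* hand -9, TIE-LOCUS.md §2–3 (crux directory; OURS).
-/

noncomputable section

set_option linter.dupNamespace false -- mandated namespace of this single-conjunct summit

open IsLocalRing Literature.AlgebraicGeometry.Resolution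
open Summit.ResolutionOfSingularities.ResolutionOfSingularities.Theorems
open Summit.ResolutionOfSingularities.ResolutionOfSingularities.Theorems.ContactCylinder

namespace Summit.ResolutionOfSingularities.ResolutionOfSingularities.Cruxes.HypersurfaceCentreConstruction.LocalEngine

namespace Iota3

/-! ## §1 The order letter does not rise at the pinned successor -/

/-- In a regular local ring `L` of Krull dimension `3` with `𝔪 = (T, z, W)`, an element `c W^ν + T H` with `c` a unit is NOT in `𝔪^{ν+1}`
(weighted quasi-regularity for the weights `(ν+1, 1, 1)`: `𝔪^{ν+1} + (T) ⊆ 𝒥_{ν+1}` and a unit monomial `c W^ν` is not in `𝒥_{ν·1+1}`).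
[cite: Matsumura1987, Thm. 16.2] -/
theorem unit_mul_pow_add_mul_not_mem_pow_succ {L : Type} [CommRing L] [IsRegularLocalRing L] (hdim : ringKrullDim L = (3 : ℕ))
    {T z W c H : L} (hspan : Ideal.span {T, z, W} = maximalIdeal L) (hc : IsUnit c) (ν : ℕ) :
    c * W ^ ν + T * H ∉ maximalIdeal L ^ (ν + 1) := by
  intro hmem
  have hu : Ideal.span (Set.range ![T, z, W]) = maximalIdeal L := by rw [range_three]; exact hspan
  have hw : ∀ i, 0 < (![ν + 1, 1, 1] : Fin 3 → ℕ) i := fun i => by fin_cases i <;> simp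
  have hle : maximalIdeal L ^ (ν + 1) ≤ weightedMonomialIdeal ![T, z, W] ![ν + 1, 1, 1] (ν + 1) :=
    pow_le_weightedMonomialIdeal_of_span_eq _ _ hw hu (ν + 1)
  have hT : T * H ∈ weightedMonomialIdeal ![T, z, W] ![ν + 1, 1, 1] (ν + 1) :=
    Ideal.mul_mem_right _ _ (self_mem_weightedMonomialIdeal ![T, z, W] ![ν + 1, 1, 1] 0)
  have hmono : c * W ^ ν ∈ weightedMonomialIdeal ![T, z, W] ![ν + 1, 1, 1] ((![ν + 1, 1, 1] : Fin 3 → ℕ) 2 * ν + 1) := by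
    have h1 : c * W ^ ν = (c * W ^ ν + T * H) - T * H := by ring
    rw [show (![ν + 1, 1, 1] : Fin 3 → ℕ) 2 * ν + 1 = ν + 1 by simp, h1]
    exact Ideal.sub_mem _ (hle hmem) hT
  have hcm : c ∈ maximalIdeal L := mem_maximalIdeal_of_monomial_mem ![T, z, W] hu hdim ![ν + 1, 1, 1] hw 2 ν hmono
  exact ((IsLocalRing.mem_maximalIdeal c).mp hcm) hc

/-- **The ORDER letter does not rise at the pinned successor** (every presentation): for `f = c y^ν + h` (`c` a unit,
`h ∈ 𝒥_{rν+1}((y,x);(r,q))`, `f ∈ 𝒥_{rν} ∖ 𝔪^{ν+1}`, `0 < q ≤ r`) and a prime `𝔫` of the cobordant algebra with `B_𝔫` regular local of Krull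
dimension `3` and `(t⁻¹, z, W)/1` spanning `𝔪_{B_𝔫}`, `y = (t⁻¹)^r W`: every saturated transform has `g/1 ∉ 𝔪_{B_𝔫}^{ν+1}`.
[OURS · L1 W4.3 · TIE-LOCUS §2] [cite: Wlodarczyk2022, §3.3] -/
theorem transform_not_mem_pow_succ_of_normalForm {S : Type} [CommRing S] [IsRegularLocalRing S] {y x z : S} {q r ν : ℕ} {f c h : S}
    (hyxz : Ideal.span (Set.range ![y, x, z]) = maximalIdeal S) (hd : (maximalIdeal S).spanFinrank = 3)
    (hq : 0 < q) (hqr : q ≤ r) (hfν : f ∉ maximalIdeal S ^ (ν + 1)) (hadm : f ∈ weightedMonomialIdeal ![y, x] ![r, q] (r * ν))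
    (hc : IsUnit c) (hh : h ∈ weightedMonomialIdeal ![y, x] ![r, q] (r * ν + 1)) (hf : f = c * y ^ ν + h)
    {n : ℕ} (u : Fin n → S) (w : Fin n → ℕ) (hpres : ∀ m : ℕ, weightedMonomialIdeal u w m = weightedMonomialIdeal ![y, x] ![r, q] m)
    (𝔫 : Ideal (cobordantAlgebra' u w)) [𝔫.IsPrime]
    (W : cobordantAlgebra' u w) (hW : algebraMap S (cobordantAlgebra' u w) y = cobordantT' u w ^ r * W)
    (hreg : IsRegularLocalRing (Localization.AtPrime 𝔫)) (hdim : ringKrullDim (Localization.AtPrime 𝔫) = (3 : ℕ))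
    (hspan : Ideal.span {algebraMap _ (Localization.AtPrime 𝔫) (cobordantT' u w),
      algebraMap _ (Localization.AtPrime 𝔫) (algebraMap S (cobordantAlgebra' u w) z),
      algebraMap _ (Localization.AtPrime 𝔫) W} = maximalIdeal (Localization.AtPrime 𝔫))
    {a : ℕ} {g : cobordantAlgebra' u w} (hfg : algebraMap S (cobordantAlgebra' u w) f = cobordantT' u w ^ a * g)
    (hTg : ¬ cobordantT' u w ∣ g) :
    algebraMap (cobordantAlgebra' u w) (Localization.AtPrime 𝔫) g ∉ maximalIdeal (Localization.AtPrime 𝔫) ^ (ν + 1) := by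
  haveI := hreg
  obtain ⟨H, hH⟩ := exists_transform_eq_of_normalForm hyxz hd hq hqr hfν hadm hh hf u w hpres W hW hfg hTg
  have hc' : IsUnit (algebraMap (cobordantAlgebra' u w) (Localization.AtPrime 𝔫) (algebraMap S (cobordantAlgebra' u w) c)) :=
    (hc.map (algebraMap S (cobordantAlgebra' u w))).map (algebraMap (cobordantAlgebra' u w) (Localization.AtPrime 𝔫))
  have key := unit_mul_pow_add_mul_not_mem_pow_succ hdim hspan hc' ν
    (H := algebraMap (cobordantAlgebra' u w) (Localization.AtPrime 𝔫) H)
  have hg' : algebraMap (cobordantAlgebra' u w) (Localization.AtPrime 𝔫) g =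
      algebraMap (cobordantAlgebra' u w) (Localization.AtPrime 𝔫) (algebraMap S (cobordantAlgebra' u w) c) *
        algebraMap (cobordantAlgebra' u w) (Localization.AtPrime 𝔫) W ^ ν +
      algebraMap (cobordantAlgebra' u w) (Localization.AtPrime 𝔫) (cobordantT' u w) *
        algebraMap (cobordantAlgebra' u w) (Localization.AtPrime 𝔫) H := by
    rw [hH, map_add, map_mul, map_mul, map_pow]
  rw [hg']
  exact key

/-! ## §2 The gap list of record: hD + (D-b³-point) + (ISO) + (SIGMA) -/

/-- **(D-b³-curve-FRAC-TIE-ZERO) ⟸ (D-b³-curve-FRAC-TIE-ZERO-ISO-SIGMA)**, verbatim binders of hand -9's clause: at the pinned successor the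
`ι₃ᵗ`-drop follows from (ISO) `IsIsolatedPosition (B_𝔫) (g/1)` and (SIGMA) `σ(B_𝔫, g/1) < σ(S_P, f/1)` — the order letter is stationary
(`transform_mem_pow_of_mem_tieZero`, `transform_not_mem_pow_succ_of_normalForm`), `ε = τ = 0` on both sides and the cylinders are read at `P` /
pointwise (…CurveFracTieZeroSigmaReduction). [OURS · L1 W4.3 · TIE-LOCUS §2] [cite: Wlodarczyk2022, §3.3] -/
theorem curveFracTieZero_of_iso_sigma (p : ℕ)
    (hISOSIGMA : ∀ (k₀ : Type) [Field k₀] [CharP k₀ p] [PerfectField k₀]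
      (S : Type) [CommRing S] [Algebra k₀ S] [Algebra.EssFiniteType k₀ S] [IsRegularLocalRing S]
      (f : S), ringKrullDim S = 3 → f ≠ 0 → f ∈ (maximalIdeal S) ^ 2 →
      ∀ (P : Ideal S) [P.IsPrime], IsRegularLocalRing (S ⧸ P) → f ∈ P →
        topStratum iotaOrdEpsTau S f = {𝔮 | P ≤ 𝔮.asIdeal} → ¬ ringKrullDim (Localization.AtPrime P) ≤ 1 →
        P ≠ maximalIdeal S →
        ∀ (x y z : S) (q r ν : ℕ) (_ : (Ideal.span ({x, y} : Set S)).IsPrime), Ideal.span {x, y, z} = maximalIdeal S →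
          P = Ideal.span {x, y} → 2 ≤ q → q ≤ r → 1 ≤ ν → f ∈ maximalIdeal S ^ ν → f ∉ maximalIdeal S ^ (ν + 1) →
          IsLexMaxWeightedCentreGerm (Localization.AtPrime (Ideal.span ({x, y} : Set S)))
            (Ideal.span {algebraMap S (Localization.AtPrime (Ideal.span ({x, y} : Set S))) f})
            ![algebraMap S (Localization.AtPrime (Ideal.span ({x, y} : Set S))) y,
              algebraMap S (Localization.AtPrime (Ideal.span ({x, y} : Set S))) x] ![r, q] (r * ν) →
          1 ≤ r / q → f ∈ weightedMonomialIdeal ![y, x] ![r / q, 1] (r / q * ν) →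
          (∀ m : ℕ, jFlatT S f m = weightedMonomialIdeal ![y, x] ![r / q, 1] m) →
        ∀ (n : ℕ) (u : Fin n → S) (w : Fin n → ℕ),
          Ideal.span (Set.range u) = maximalIdeal S → (maximalIdeal S).spanFinrank = n → (∃ i, 0 < w i) →
          Ideal.span {x | ∃ i, 0 < w i ∧ x = u i} = P →
          (∀ m : ℕ, weightedMonomialIdeal u w m = jFlatT S f m) →
          ∀ (𝔫 : Ideal (cobordantAlgebra' u w)) [𝔫.IsPrime], IsTHomogeneous u w 𝔫 → cobordantT' u w ∈ 𝔫 →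
            (maximalIdeal S).map (algebraMap S (cobordantAlgebra' u w)) ≤ 𝔫 →
            ¬ extReesAlgebra.vertexIdeal (weightedMonomialIdeal u w) ≤ 𝔫 →
            ∀ (a : ℕ) (g : cobordantAlgebra' u w), algebraMap S (cobordantAlgebra' u w) f = cobordantT' u w ^ a * g →
              ¬ cobordantT' u w ∣ g →
              algebraMap (cobordantAlgebra' u w) (Localization.AtPrime 𝔫) g ∈ maximalIdeal (Localization.AtPrime 𝔫) ^ 2 →
              f ∈ weightedMonomialIdeal ![x, y, z] ![1, r / q + 1, 1] ((r / q + 1) * ν) →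
              ∀ W : cobordantAlgebra' u w, algebraMap S (cobordantAlgebra' u w) y = cobordantT' u w ^ (r / q) * W →
                𝔫 = Ideal.span {cobordantT' u w, algebraMap S (cobordantAlgebra' u w) z, W} →
                IsRegularLocalRing (Localization.AtPrime 𝔫) → ringKrullDim (Localization.AtPrime 𝔫) = (3 : ℕ) →
                Ideal.span {algebraMap _ (Localization.AtPrime 𝔫) (cobordantT' u w),
                  algebraMap _ (Localization.AtPrime 𝔫) (algebraMap S (cobordantAlgebra' u w) z),
                  algebraMap _ (Localization.AtPrime 𝔫) W} = maximalIdeal (Localization.AtPrime 𝔫) →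
              IsIsolatedPosition (Localization.AtPrime 𝔫) (algebraMap (cobordantAlgebra' u w) (Localization.AtPrime 𝔫) g) ∧
              iotaSigma (Localization.AtPrime 𝔫) (algebraMap (cobordantAlgebra' u w) (Localization.AtPrime 𝔫) g) <
                iotaSigma (Localization.AtPrime P) (algebraMap S (Localization.AtPrime P) f)) :
    ∀ (k₀ : Type) [Field k₀] [CharP k₀ p] [PerfectField k₀]
      (S : Type) [CommRing S] [Algebra k₀ S] [Algebra.EssFiniteType k₀ S] [IsRegularLocalRing S]
      (f : S), ringKrullDim S = 3 → f ≠ 0 → f ∈ (maximalIdeal S) ^ 2 →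
      ∀ (P : Ideal S) [P.IsPrime], IsRegularLocalRing (S ⧸ P) → f ∈ P →
        topStratum iotaOrdEpsTau S f = {𝔮 | P ≤ 𝔮.asIdeal} → ¬ ringKrullDim (Localization.AtPrime P) ≤ 1 →
        P ≠ maximalIdeal S →
        ∀ (x y z : S) (q r ν : ℕ) (_ : (Ideal.span ({x, y} : Set S)).IsPrime), Ideal.span {x, y, z} = maximalIdeal S →
          P = Ideal.span {x, y} → 2 ≤ q → q ≤ r → 1 ≤ ν → f ∈ maximalIdeal S ^ ν → f ∉ maximalIdeal S ^ (ν + 1) →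
          IsLexMaxWeightedCentreGerm (Localization.AtPrime (Ideal.span ({x, y} : Set S)))
            (Ideal.span {algebraMap S (Localization.AtPrime (Ideal.span ({x, y} : Set S))) f})
            ![algebraMap S (Localization.AtPrime (Ideal.span ({x, y} : Set S))) y,
              algebraMap S (Localization.AtPrime (Ideal.span ({x, y} : Set S))) x] ![r, q] (r * ν) →
          1 ≤ r / q → f ∈ weightedMonomialIdeal ![y, x] ![r / q, 1] (r / q * ν) →
          (∀ m : ℕ, jFlatT S f m = weightedMonomialIdeal ![y, x] ![r / q, 1] m) →
        ∀ (n : ℕ) (u : Fin n → S) (w : Fin n → ℕ),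
          Ideal.span (Set.range u) = maximalIdeal S → (maximalIdeal S).spanFinrank = n → (∃ i, 0 < w i) →
          Ideal.span {x | ∃ i, 0 < w i ∧ x = u i} = P →
          (∀ m : ℕ, weightedMonomialIdeal u w m = jFlatT S f m) →
          ∀ (𝔫 : Ideal (cobordantAlgebra' u w)) [𝔫.IsPrime], IsTHomogeneous u w 𝔫 → cobordantT' u w ∈ 𝔫 →
            (maximalIdeal S).map (algebraMap S (cobordantAlgebra' u w)) ≤ 𝔫 →
            ¬ extReesAlgebra.vertexIdeal (weightedMonomialIdeal u w) ≤ 𝔫 →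
            ∀ (a : ℕ) (g : cobordantAlgebra' u w), algebraMap S (cobordantAlgebra' u w) f = cobordantT' u w ^ a * g →
              ¬ cobordantT' u w ∣ g →
              algebraMap (cobordantAlgebra' u w) (Localization.AtPrime 𝔫) g ∈ maximalIdeal (Localization.AtPrime 𝔫) ^ 2 →
              f ∈ weightedMonomialIdeal ![x, y, z] ![1, r / q + 1, 1] ((r / q + 1) * ν) →
              ∀ W : cobordantAlgebra' u w, algebraMap S (cobordantAlgebra' u w) y = cobordantT' u w ^ (r / q) * W →
                𝔫 = Ideal.span {cobordantT' u w, algebraMap S (cobordantAlgebra' u w) z, W} →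
                IsRegularLocalRing (Localization.AtPrime 𝔫) → ringKrullDim (Localization.AtPrime 𝔫) = (3 : ℕ) →
                Ideal.span {algebraMap _ (Localization.AtPrime 𝔫) (cobordantT' u w),
                  algebraMap _ (Localization.AtPrime 𝔫) (algebraMap S (cobordantAlgebra' u w) z),
                  algebraMap _ (Localization.AtPrime 𝔫) W} = maximalIdeal (Localization.AtPrime 𝔫) →
              iotaFlatT (Localization.AtPrime 𝔫) (algebraMap (cobordantAlgebra' u w) (Localization.AtPrime 𝔫) g) <
                iotaFlatT S f := by
  intro k₀ _ _ _ S _ _ _ _ f hd hf0 hf2 P _ hreg hfP hE hP1 hPm x y z q r ν hPxy hxyz hPeq hq2 hqr hν1 hfν hfν1 hlex hb1 hadm hJ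
    n u w h1 h2 h3 h4 h5 𝔫 _ hhom hT hM hV a g hfg hTg hg2 hft0 W hW h𝔫 hR1 hR2 hR3
  classical
  obtain ⟨hiso, hσ⟩ := hISOSIGMA k₀ S f hd hf0 hf2 P hreg hfP hE hP1 hPm x y z q r ν hPxy hxyz hPeq hq2 hqr hν1 hfν hfν1 hlex hb1
    hadm hJ n u w h1 h2 h3 h4 h5 𝔫 hhom hT hM hV a g hfg hTg hg2 hft0 W hW h𝔫 hR1 hR2 hR3
  haveI := hR1
  have hd3 : ringKrullDim S = (3 : ℕ) := by rw [hd]; rfl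
  have hrk : (maximalIdeal S).spanFinrank = 3 := by
    have h := IsRegularLocalRing.spanFinrank_maximalIdeal (R := S)
    rw [hd3] at h
    exact_mod_cast h
  have hyxz : Ideal.span (Set.range ![y, x, z]) = maximalIdeal S := by rw [range_three, Set.insert_comm]; exact hxyz
  -- the AQS-adapted normal form `f = c y^ν + h` (hand -8's first reduction + unit cofactor)
  obtain ⟨_, hlex'⟩ := exists_isLexMax_of_eq hPeq.symm hlex
  have hcop' : Nat.Coprime r q := by simpa using hlex'.2.2.1
  have hndvd : ¬ q ∣ r := fun hdvd => by
    have h1 : Nat.gcd r q = 1 := hcop'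
    rw [Nat.gcd_eq_right hdvd] at h1
    omega
  have hsup := mem_span_pow_sup_of_curve_lexMax_frac hd P hPeq.symm hxyz hν1 hndvd hlex'
  obtain ⟨c, h, hc, hh, hf⟩ := exists_normalForm_of_mem_sup hyxz hb1 hsup hfν1
  have hpres : ∀ m : ℕ, weightedMonomialIdeal u w m = weightedMonomialIdeal ![y, x] ![r / q, 1] m := fun m => by rw [h5 m, hJ m]
  -- the order letter is stationary at the pinned successor
  have hgν : algebraMap (cobordantAlgebra' u w) (Localization.AtPrime 𝔫) g ∈ maximalIdeal (Localization.AtPrime 𝔫) ^ ν :=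
    transform_mem_pow_of_mem_tieZero hyxz hrk Nat.one_pos hb1 hfν1 hadm hft0 u w hpres 𝔫 hM W hW h𝔫 hR1 hR2 hR3 hfg hTg
  have hgν1 : algebraMap (cobordantAlgebra' u w) (Localization.AtPrime 𝔫) g ∉ maximalIdeal (Localization.AtPrime 𝔫) ^ (ν + 1) :=
    transform_not_mem_pow_succ_of_normalForm hyxz hrk Nat.one_pos hb1 hfν1 hadm hc (by simpa [Nat.mul_comm] using hh) hf u w hpres
      𝔫 W hW hR1 hR2 hR3 hfg hTg
  exact iotaFlatT_lt_of_curve_of_isIsolated_of_iotaSigma_lt (le_of_eq hd) hf0 P hfP hE hPm hfν hfν1 (le_of_eq hR2) hgν hgν1 hiso hσ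

end Iota3

open Iota3

/-- **GAP LIST OF RECORD for `stub_keyRungGrHomLE_three` — hD + (D-b³-point) + (D-b³-curve-FRAC-TIE-ZERO-ISO-SIGMA)** (module docstring):
the curve regime of (D-b³) costs, per fractional-slope curve centre tied at `λ = 0` and at ONE regular local threefold `B_𝔫`, `𝔫 = (t⁻¹, z, y t^b)`,
the ISOLATION of the transform (its equimultiple locus is the closed point) and the DROP OF THE FLAG-SLOPE LETTER `σ(B_𝔫, g/1) < σ(S_P, f/1)`.
[OURS · L1 W4.3 · audit glue] -/
theorem keyRungGrHomLE_three_of_tieDescent_point_curveFracTieZeroSigma (p : ℕ)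
    (hD : ∀ (T T' : Type) [CommRing T] [IsRegularLocalRing T] [CommRing T'] [IsRegularLocalRing T'] [Algebra T T']
      [IsLocalHom (algebraMap T T')] [Algebra.FormallySmooth T T'] [Algebra.EssFiniteType T T'] (g : T),
      ringKrullDim T' ≤ 3 → IsTiePosition T' (algebraMap T T' g) → IsTiePosition T g)
    (hPOINT : ∀ (k₀ : Type) [Field k₀] [CharP k₀ p] [PerfectField k₀]
      (S : Type) [CommRing S] [Algebra k₀ S] [Algebra.EssFiniteType k₀ S] [IsRegularLocalRing S]
      (f : S), ringKrullDim S = 3 → f ≠ 0 → f ∈ (maximalIdeal S) ^ 2 →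
      ∀ (P : Ideal S) [P.IsPrime], IsRegularLocalRing (S ⧸ P) → f ∈ P →
        topStratum iotaOrdEpsTau S f = {𝔮 | P ≤ 𝔮.asIdeal} → ¬ ringKrullDim (Localization.AtPrime P) ≤ 1 →
        P = maximalIdeal S →
        ∀ (n : ℕ) (u : Fin n → S) (w : Fin n → ℕ),
          Ideal.span (Set.range u) = maximalIdeal S → (maximalIdeal S).spanFinrank = n → (∃ i, 0 < w i) →
          Ideal.span {x | ∃ i, 0 < w i ∧ x = u i} = P →
          (∀ m : ℕ, weightedMonomialIdeal u w m = jFlatT S f m) →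
          ∀ (𝔫 : Ideal (cobordantAlgebra' u w)) [𝔫.IsPrime], IsTHomogeneous u w 𝔫 → cobordantT' u w ∈ 𝔫 →
            (maximalIdeal S).map (algebraMap S (cobordantAlgebra' u w)) ≤ 𝔫 →
            ¬ extReesAlgebra.vertexIdeal (weightedMonomialIdeal u w) ≤ 𝔫 →
            ∀ (a : ℕ) (g : cobordantAlgebra' u w), algebraMap S (cobordantAlgebra' u w) f = cobordantT' u w ^ a * g →
              ¬ cobordantT' u w ∣ g →
              algebraMap (cobordantAlgebra' u w) (Localization.AtPrime 𝔫) g ∈ maximalIdeal (Localization.AtPrime 𝔫) ^ 2 →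
              iotaFlatT (Localization.AtPrime 𝔫) (algebraMap (cobordantAlgebra' u w) (Localization.AtPrime 𝔫) g) <
                iotaFlatT S f)
    (hISOSIGMA : ∀ (k₀ : Type) [Field k₀] [CharP k₀ p] [PerfectField k₀]
      (S : Type) [CommRing S] [Algebra k₀ S] [Algebra.EssFiniteType k₀ S] [IsRegularLocalRing S]
      (f : S), ringKrullDim S = 3 → f ≠ 0 → f ∈ (maximalIdeal S) ^ 2 →
      ∀ (P : Ideal S) [P.IsPrime], IsRegularLocalRing (S ⧸ P) → f ∈ P →
        topStratum iotaOrdEpsTau S f = {𝔮 | P ≤ 𝔮.asIdeal} → ¬ ringKrullDim (Localization.AtPrime P) ≤ 1 →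
        P ≠ maximalIdeal S →
        ∀ (x y z : S) (q r ν : ℕ) (_ : (Ideal.span ({x, y} : Set S)).IsPrime), Ideal.span {x, y, z} = maximalIdeal S →
          P = Ideal.span {x, y} → 2 ≤ q → q ≤ r → 1 ≤ ν → f ∈ maximalIdeal S ^ ν → f ∉ maximalIdeal S ^ (ν + 1) →
          IsLexMaxWeightedCentreGerm (Localization.AtPrime (Ideal.span ({x, y} : Set S)))
            (Ideal.span {algebraMap S (Localization.AtPrime (Ideal.span ({x, y} : Set S))) f})
            ![algebraMap S (Localization.AtPrime (Ideal.span ({x, y} : Set S))) y,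
              algebraMap S (Localization.AtPrime (Ideal.span ({x, y} : Set S))) x] ![r, q] (r * ν) →
          1 ≤ r / q → f ∈ weightedMonomialIdeal ![y, x] ![r / q, 1] (r / q * ν) →
          (∀ m : ℕ, jFlatT S f m = weightedMonomialIdeal ![y, x] ![r / q, 1] m) →
        ∀ (n : ℕ) (u : Fin n → S) (w : Fin n → ℕ),
          Ideal.span (Set.range u) = maximalIdeal S → (maximalIdeal S).spanFinrank = n → (∃ i, 0 < w i) →
          Ideal.span {x | ∃ i, 0 < w i ∧ x = u i} = P →
          (∀ m : ℕ, weightedMonomialIdeal u w m = jFlatT S f m) →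
          ∀ (𝔫 : Ideal (cobordantAlgebra' u w)) [𝔫.IsPrime], IsTHomogeneous u w 𝔫 → cobordantT' u w ∈ 𝔫 →
            (maximalIdeal S).map (algebraMap S (cobordantAlgebra' u w)) ≤ 𝔫 →
            ¬ extReesAlgebra.vertexIdeal (weightedMonomialIdeal u w) ≤ 𝔫 →
            ∀ (a : ℕ) (g : cobordantAlgebra' u w), algebraMap S (cobordantAlgebra' u w) f = cobordantT' u w ^ a * g →
              ¬ cobordantT' u w ∣ g →
              algebraMap (cobordantAlgebra' u w) (Localization.AtPrime 𝔫) g ∈ maximalIdeal (Localization.AtPrime 𝔫) ^ 2 →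
              f ∈ weightedMonomialIdeal ![x, y, z] ![1, r / q + 1, 1] ((r / q + 1) * ν) →
              ∀ W : cobordantAlgebra' u w, algebraMap S (cobordantAlgebra' u w) y = cobordantT' u w ^ (r / q) * W →
                𝔫 = Ideal.span {cobordantT' u w, algebraMap S (cobordantAlgebra' u w) z, W} →
                IsRegularLocalRing (Localization.AtPrime 𝔫) → ringKrullDim (Localization.AtPrime 𝔫) = (3 : ℕ) →
                Ideal.span {algebraMap _ (Localization.AtPrime 𝔫) (cobordantT' u w),
                  algebraMap _ (Localization.AtPrime 𝔫) (algebraMap S (cobordantAlgebra' u w) z),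
                  algebraMap _ (Localization.AtPrime 𝔫) W} = maximalIdeal (Localization.AtPrime 𝔫) →
              IsIsolatedPosition (Localization.AtPrime 𝔫) (algebraMap (cobordantAlgebra' u w) (Localization.AtPrime 𝔫) g) ∧
              iotaSigma (Localization.AtPrime 𝔫) (algebraMap (cobordantAlgebra' u w) (Localization.AtPrime 𝔫) g) <
                iotaSigma (Localization.AtPrime P) (algebraMap S (Localization.AtPrime P) f)) :
    KeyRungGrHomLE 3 p :=
  keyRungGrHomLE_three_of_tieDescent_point_curveFracTieZero p hD hPOINT (curveFracTieZero_of_iso_sigma p hISOSIGMA)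

/-- **GAP LIST OF RECORD, (c11)-form — (c11)≤3 + (D-b³-point) + (D-b³-curve-FRAC-TIE-ZERO-ISO-SIGMA).** [OURS · L1 W4.3 · audit glue] -/
theorem keyRungGrHomLE_three_of_c11_point_curveFracTieZeroSigma (p : ℕ) (hc11 : IotaJEssSmoothCompatibleLE 3 iotaFlatT jFlatT)
    (hPOINT : ∀ (k₀ : Type) [Field k₀] [CharP k₀ p] [PerfectField k₀]
      (S : Type) [CommRing S] [Algebra k₀ S] [Algebra.EssFiniteType k₀ S] [IsRegularLocalRing S]
      (f : S), ringKrullDim S = 3 → f ≠ 0 → f ∈ (maximalIdeal S) ^ 2 →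
      ∀ (P : Ideal S) [P.IsPrime], IsRegularLocalRing (S ⧸ P) → f ∈ P →
        topStratum iotaOrdEpsTau S f = {𝔮 | P ≤ 𝔮.asIdeal} → ¬ ringKrullDim (Localization.AtPrime P) ≤ 1 →
        P = maximalIdeal S →
        ∀ (n : ℕ) (u : Fin n → S) (w : Fin n → ℕ),
          Ideal.span (Set.range u) = maximalIdeal S → (maximalIdeal S).spanFinrank = n → (∃ i, 0 < w i) →
          Ideal.span {x | ∃ i, 0 < w i ∧ x = u i} = P →
          (∀ m : ℕ, weightedMonomialIdeal u w m = jFlatT S f m) →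
          ∀ (𝔫 : Ideal (cobordantAlgebra' u w)) [𝔫.IsPrime], IsTHomogeneous u w 𝔫 → cobordantT' u w ∈ 𝔫 →
            (maximalIdeal S).map (algebraMap S (cobordantAlgebra' u w)) ≤ 𝔫 →
            ¬ extReesAlgebra.vertexIdeal (weightedMonomialIdeal u w) ≤ 𝔫 →
            ∀ (a : ℕ) (g : cobordantAlgebra' u w), algebraMap S (cobordantAlgebra' u w) f = cobordantT' u w ^ a * g →
              ¬ cobordantT' u w ∣ g →
              algebraMap (cobordantAlgebra' u w) (Localization.AtPrime 𝔫) g ∈ maximalIdeal (Localization.AtPrime 𝔫) ^ 2 →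
              iotaFlatT (Localization.AtPrime 𝔫) (algebraMap (cobordantAlgebra' u w) (Localization.AtPrime 𝔫) g) <
                iotaFlatT S f)
    (hISOSIGMA : ∀ (k₀ : Type) [Field k₀] [CharP k₀ p] [PerfectField k₀]
      (S : Type) [CommRing S] [Algebra k₀ S] [Algebra.EssFiniteType k₀ S] [IsRegularLocalRing S]
      (f : S), ringKrullDim S = 3 → f ≠ 0 → f ∈ (maximalIdeal S) ^ 2 →
      ∀ (P : Ideal S) [P.IsPrime], IsRegularLocalRing (S ⧸ P) → f ∈ P →
        topStratum iotaOrdEpsTau S f = {𝔮 | P ≤ 𝔮.asIdeal} → ¬ ringKrullDim (Localization.AtPrime P) ≤ 1 →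
        P ≠ maximalIdeal S →
        ∀ (x y z : S) (q r ν : ℕ) (_ : (Ideal.span ({x, y} : Set S)).IsPrime), Ideal.span {x, y, z} = maximalIdeal S →
          P = Ideal.span {x, y} → 2 ≤ q → q ≤ r → 1 ≤ ν → f ∈ maximalIdeal S ^ ν → f ∉ maximalIdeal S ^ (ν + 1) →
          IsLexMaxWeightedCentreGerm (Localization.AtPrime (Ideal.span ({x, y} : Set S)))
            (Ideal.span {algebraMap S (Localization.AtPrime (Ideal.span ({x, y} : Set S))) f})
            ![algebraMap S (Localization.AtPrime (Ideal.span ({x, y} : Set S))) y,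
              algebraMap S (Localization.AtPrime (Ideal.span ({x, y} : Set S))) x] ![r, q] (r * ν) →
          1 ≤ r / q → f ∈ weightedMonomialIdeal ![y, x] ![r / q, 1] (r / q * ν) →
          (∀ m : ℕ, jFlatT S f m = weightedMonomialIdeal ![y, x] ![r / q, 1] m) →
        ∀ (n : ℕ) (u : Fin n → S) (w : Fin n → ℕ),
          Ideal.span (Set.range u) = maximalIdeal S → (maximalIdeal S).spanFinrank = n → (∃ i, 0 < w i) →
          Ideal.span {x | ∃ i, 0 < w i ∧ x = u i} = P →
          (∀ m : ℕ, weightedMonomialIdeal u w m = jFlatT S f m) →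
          ∀ (𝔫 : Ideal (cobordantAlgebra' u w)) [𝔫.IsPrime], IsTHomogeneous u w 𝔫 → cobordantT' u w ∈ 𝔫 →
            (maximalIdeal S).map (algebraMap S (cobordantAlgebra' u w)) ≤ 𝔫 →
            ¬ extReesAlgebra.vertexIdeal (weightedMonomialIdeal u w) ≤ 𝔫 →
            ∀ (a : ℕ) (g : cobordantAlgebra' u w), algebraMap S (cobordantAlgebra' u w) f = cobordantT' u w ^ a * g →
              ¬ cobordantT' u w ∣ g →
              algebraMap (cobordantAlgebra' u w) (Localization.AtPrime 𝔫) g ∈ maximalIdeal (Localization.AtPrime 𝔫) ^ 2 →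
              f ∈ weightedMonomialIdeal ![x, y, z] ![1, r / q + 1, 1] ((r / q + 1) * ν) →
              ∀ W : cobordantAlgebra' u w, algebraMap S (cobordantAlgebra' u w) y = cobordantT' u w ^ (r / q) * W →
                𝔫 = Ideal.span {cobordantT' u w, algebraMap S (cobordantAlgebra' u w) z, W} →
                IsRegularLocalRing (Localization.AtPrime 𝔫) → ringKrullDim (Localization.AtPrime 𝔫) = (3 : ℕ) →
                Ideal.span {algebraMap _ (Localization.AtPrime 𝔫) (cobordantT' u w),
                  algebraMap _ (Localization.AtPrime 𝔫) (algebraMap S (cobordantAlgebra' u w) z),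
                  algebraMap _ (Localization.AtPrime 𝔫) W} = maximalIdeal (Localization.AtPrime 𝔫) →
              IsIsolatedPosition (Localization.AtPrime 𝔫) (algebraMap (cobordantAlgebra' u w) (Localization.AtPrime 𝔫) g) ∧
              iotaSigma (Localization.AtPrime 𝔫) (algebraMap (cobordantAlgebra' u w) (Localization.AtPrime 𝔫) g) <
                iotaSigma (Localization.AtPrime P) (algebraMap S (Localization.AtPrime P) f)) :
    KeyRungGrHomLE 3 p :=
  keyRungGrHomLE_three_of_c11_point_curveFracTieZero p hc11 hPOINT (curveFracTieZero_of_iso_sigma p hISOSIGMA)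

end Summit.ResolutionOfSingularities.ResolutionOfSingularities.Cruxes.HypersurfaceCentreConstruction.LocalEngine

end
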